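import Summits.MatrixMultiplication.MatrixMultiplication.Theorems.SoloInformedTinyHostFive

/-!
# Tiny host `ℤ/3`: the fibre trichotomy

This work, §8.7 (j). Continuation of `SoloInformedTinyHost`. For `S¹ = ℤ/3` (multipliers `±1`) the
`S¹`-data `D = (a,b,c)` of a realization satisfy (E) on every matrix-multiplication triple, and two
triples `τ = (i,j,k)`, `τ' = (i',j',k')` lie in one fibre of the untwisted chart only if they are
SEPARATED in both directions: `Sep τ τ'` (all four mixed sums `a(i,j) ± b(j',k) ± c(k',i')` nonzero,
i.e. exactly one of the three mixed cells nonzero) and `Sep τ' τ`. Write `𝒪` for the all-zero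
triples (`a(i,j) = b(j,k) = c(k,i) = 0`; by zero closure a triple outside `𝒪` has `a(i,j) ≠ 0` or
`c(k,i) ≠ 0`).

THEOREM (fibre trichotomy). Let `Λ` be a set of pairwise separated triples (a fibre). Then EITHER
`Λ ⊆ 𝒪`, OR `|Λ| ≤ 2`. The new ingredients, on top of `SoloInformedTinyHost`:
* `allzero_pair_excludes_third` — two separated all-zero triples are jointly separated from NO triple
  outside `𝒪` (so a fibre meeting `𝒪` twice is inside `𝒪`);
* `azero_no_three_separated` — a triple with `a(i₁,j₁) = 0` is never separated from two mutually
  separated triples of type `𝒵_a` (`a = 0`, `c ≠ 0`); with `TinyHost.no_three_separated` (type `𝒵_c`)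
  and `TinyHost.nonzero_inseparable` (all cross-type pairs and the clique `a ≠ 0 ≠ c`) this bounds every
  fibre that is not inside `𝒪` by `2`.
CONSEQUENCE (§8.7 (j)). `|S⁰| ≥ (n³ − |𝒪″|)/2 + Φ`, where `Φ` is the number of fibres inside `𝒪` and
`𝒪″` their union; a realization of `⟨n,n,n⟩` over `S⁰ × ℤ/3` with rank `< n³` (i.e. `|S⁰| < n³/2`)
must therefore contain fibres of ≥ 3 pairwise separated ALL-ZERO triples — the one-fibre toy shape —
in bulk. References: this work §8.7; CohnUmans2013 (arXiv:1207.6528) Def. 12.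
-/

namespace Summit.MatrixMultiplication.MatrixMultiplication.Theorems.TwistedTPP

namespace TinyHost

variable {G : Type*} (D : Data G)

/-- Separation of the ordered pair `τ = (i,j,k) ← τ' = (i',j',k')`: all four mixed sums
`a(i,j) ± b(j',k) ± c(k',i')` are nonzero. [this work, §8.7 (j)] -/
def Data.Sep (D : Data G) (i j k i' j' k' : G) : Prop :=
  D.a i j + D.b j' k + D.c k' i' ≠ 0 ∧ D.a i j + D.b j' k - D.c k' i' ≠ 0 ∧
    D.a i j - D.b j' k + D.c k' i' ≠ 0 ∧ D.a i j - D.b j' k - D.c k' i' ≠ 0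

/-- `Sep` unfolds to "exactly one mixed cell is nonzero". [this work, §8.7 (j)] -/
theorem sep_iff {i j k i' j' k' : G} : D.Sep i j k i' j' k' ↔
    ((D.a i j ≠ 0 ∧ D.b j' k = 0 ∧ D.c k' i' = 0) ∨ (D.a i j = 0 ∧ D.b j' k ≠ 0 ∧ D.c k' i' = 0) ∨
      (D.a i j = 0 ∧ D.b j' k = 0 ∧ D.c k' i' ≠ 0)) := by
  unfold Data.Sep
  exact mixed_nonvanishing_iff _ _ _

/-- Two ALL-ZERO triples are separated (`τ₁ ← τ₂`) iff the cross cell `b(j₂,k₁)` is nonzero.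
[this work, §8.7 (j)] -/
theorem sep_allzero_iff {i₁ j₁ k₁ i₂ j₂ k₂ : G} (ha₁ : D.a i₁ j₁ = 0) (hc₂ : D.c k₂ i₂ = 0) :
    D.Sep i₁ j₁ k₁ i₂ j₂ k₂ ↔ D.b j₂ k₁ ≠ 0 := by
  rw [sep_iff]
  constructor
  · rintro (⟨h, _, _⟩ | ⟨_, h, _⟩ | ⟨_, _, h⟩)
    · exact (h ha₁).elim
    · exact h
    · exact (h hc₂).elim
  · intro hb
    exact Or.inr (Or.inl ⟨ha₁, hb, hc₂⟩)

/-- If `τ ← τ'` is separated and `a(i,j) = 0`, `c(k',i') ≠ 0`, then the cross cell `b(j',k)`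
vanishes. [this work, §8.7 (j)] -/
theorem cross_b_zero_of_sep' {i j k i' j' k' : G} (ha : D.a i j = 0) (hc : D.c k' i' ≠ 0)
    (h : D.Sep i j k i' j' k') : D.b j' k = 0 := by
  rw [sep_iff] at h
  rcases h with ⟨h0, _, _⟩ | ⟨_, _, h0⟩ | ⟨_, hb, _⟩
  · exact (h0 ha).elim
  · exact (hc h0).elim
  · exact hb

/-- **Two separated all-zero triples exclude every third triple outside `𝒪`.** Let
`τ₁ = (i₁,j₁,k₁)`, `τ₂ = (i₂,j₂,k₂)` be all-zero (`a = c = 0` on their own cells suffices) and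
mutually separated, and let `σ = (i,j,k)` have `a(i,j) ≠ 0` or `c(k,i) ≠ 0`. Then `σ` is not separated
(in both directions) from both `τ₁` and `τ₂`. Proof: zero closure along the chains
`b(j₁,k) = b(j₂,k) = 0 ⟹ c(k,i₁) = 0 ⟹ a(i₁,j₂) = 0 ⟹ b(j₂,k₁) = 0` (case `a(i,j) ≠ 0`) and
`b(j,k₁) = b(j,k₂) = 0 ⟹ a(i₁,j) = 0 ⟹ c(k₂,i₁) = 0 ⟹ b(j₁,k₂) = 0` (case `c(k,i) ≠ 0`).
[this work, §8.7 (j)] -/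
theorem allzero_pair_excludes_third {i₁ j₁ k₁ i₂ j₂ k₂ i j k : G}
    (ha₁ : D.a i₁ j₁ = 0) (hc₁ : D.c k₁ i₁ = 0) (ha₂ : D.a i₂ j₂ = 0) (hc₂ : D.c k₂ i₂ = 0)
    (h₁₂ : D.Sep i₁ j₁ k₁ i₂ j₂ k₂) (h₂₁ : D.Sep i₂ j₂ k₂ i₁ j₁ k₁)
    (hσ : D.a i j ≠ 0 ∨ D.c k i ≠ 0)
    (hs₁ : D.Sep i j k i₁ j₁ k₁) (ht₁ : D.Sep i₁ j₁ k₁ i j k)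
    (hs₂ : D.Sep i j k i₂ j₂ k₂) (ht₂ : D.Sep i₂ j₂ k₂ i j k) : False := by
  have hb₂₁ : D.b j₂ k₁ ≠ 0 := (sep_allzero_iff D ha₁ hc₂).1 h₁₂
  have hb₁₂ : D.b j₁ k₂ ≠ 0 := (sep_allzero_iff D ha₂ hc₁).1 h₂₁
  rcases hσ with ha | hc
  · -- σ ← τ₁ and σ ← τ₂ kill b(j₁,k) and b(j₂,k)
    have hb₁ : D.b j₁ k = 0 := cross_b_zero_of_sep D ha hs₁
    have hb₂ : D.b j₂ k = 0 := cross_b_zero_of_sep D ha hs₂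
    have hck : D.c k i₁ = 0 := zero_closure₁ D ha₁ hb₁
    have ha₁₂ : D.a i₁ j₂ = 0 := zero_closure₂ D hb₂ hck
    exact hb₂₁ (zero_closure₃ D hc₁ ha₁₂)
  · -- τ₁ ← σ and τ₂ ← σ kill b(j,k₁) and b(j,k₂)
    have hb₁ : D.b j k₁ = 0 := cross_b_zero_of_sep' D ha₁ hc ht₁
    have hb₂ : D.b j k₂ = 0 := cross_b_zero_of_sep' D ha₂ hc ht₂
    have haj : D.a i₁ j = 0 := zero_closure₂ D hb₁ hc₁
    have hc₂₁ : D.c k₂ i₁ = 0 := zero_closure₁ D haj hb₂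
    exact hb₁₂ (zero_closure₃ D hc₂₁ ha₁)

/-- **No triple with `a(i₁,j₁) = 0` is separated from two mutually separated triples of type `𝒵_a`**
(`a = 0`, `c ≠ 0`). In particular no three type-`𝒵_a` triples are pairwise separated, and an all-zero
triple has at most one type-`𝒵_a` companion in its fibre. (The type-`𝒵_c` statement is
`TinyHost.no_three_separated`.) [this work, §8.7 (j)] -/
theorem azero_no_three_separated {i₁ j₁ k₁ i j k i' j' k' : G} (ha₁ : D.a i₁ j₁ = 0)
    (ha : D.a i j = 0) (hc : D.c k i ≠ 0) (hc' : D.c k' i' ≠ 0)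
    (ht : D.Sep i₁ j₁ k₁ i j k) (ht' : D.Sep i₁ j₁ k₁ i' j' k') (hss : D.Sep i j k i' j' k') :
    False := by
  have hb₁ : D.b j k₁ = 0 := cross_b_zero_of_sep' D ha₁ hc ht
  have hb₁' : D.b j' k₁ = 0 := cross_b_zero_of_sep' D ha₁ hc' ht'
  have hbx : D.b j' k = 0 := cross_b_zero_of_sep' D ha hc' hss
  -- a(i,j') ≠ 0: otherwise c(k,i) = 0 by zero closure with b(j',k) = 0
  have haij' : D.a i j' ≠ 0 := fun h0 => hc (zero_closure₁ D h0 hbx)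
  have hck₁ : D.c k₁ i = 0 := zero_closure₁ D ha hb₁
  exact haij' (zero_closure₂ D hb₁' hck₁)

/-- Cross-type pairs never share a fibre (restated with `Sep`): a triple with `a ≠ 0` is not
separated from one with `c ≠ 0` in the direction `τ ← τ'`. [this work, §8.7 (j)] -/
theorem not_sep_of_a_ne_c_ne {i j k i' j' k' : G} (ha : D.a i j ≠ 0) (hc : D.c k' i' ≠ 0) :
    ¬ D.Sep i j k i' j' k' :=
  nonzero_inseparable D ha hc

/-- Outside `𝒪` a triple has `a ≠ 0` or `c ≠ 0` (two zeros force the third). [this work, §8.7 (j)] -/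
theorem a_ne_or_c_ne_of_not_allzero {i j k : G}
    (h : ¬ (D.a i j = 0 ∧ D.b j k = 0 ∧ D.c k i = 0)) : D.a i j ≠ 0 ∨ D.c k i ≠ 0 := by
  by_cases ha : D.a i j = 0
  · by_cases hc : D.c k i = 0
    · exact (h ⟨ha, zero_closure₃ D hc ha, hc⟩).elim
    · exact Or.inr hc
  · exact Or.inl ha

/-- **Fibre trichotomy, the quantitative form used in §8.7 (j):** three pairwise separated triples
one of which, `τ₁`, is all-zero (`a = c = 0` on its cells, whence `b = 0` by zero closure): then the
two other members `σ, σ'` of the fibre are all-zero too. Equivalently: a fibre is inside `𝒪` or has at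
most two elements.
[this work, §8.7 (j)] -/
theorem allzero_fibre_of_three {i₁ j₁ k₁ i j k i' j' k' : G}
    (ha₁ : D.a i₁ j₁ = 0) (hc₁ : D.c k₁ i₁ = 0)
    (ht : D.Sep i₁ j₁ k₁ i j k) (hs : D.Sep i j k i₁ j₁ k₁)
    (ht' : D.Sep i₁ j₁ k₁ i' j' k') (hs' : D.Sep i' j' k' i₁ j₁ k₁)
    (hss' : D.Sep i j k i' j' k') (hs's : D.Sep i' j' k' i j k) :
    (D.a i j = 0 ∧ D.b j k = 0 ∧ D.c k i = 0) ∧ (D.a i' j' = 0 ∧ D.b j' k' = 0 ∧ D.c k' i' = 0) := by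
  by_cases hσ : D.a i j = 0 ∧ D.b j k = 0 ∧ D.c k i = 0
  · by_cases hσ' : D.a i' j' = 0 ∧ D.b j' k' = 0 ∧ D.c k' i' = 0
    · exact ⟨hσ, hσ'⟩
    · exact (allzero_pair_excludes_third D ha₁ hc₁ hσ.1 hσ.2.2 ht hs
        (a_ne_or_c_ne_of_not_allzero D hσ') hs' ht' hs's hss').elim
  · by_cases hσ' : D.a i' j' = 0 ∧ D.b j' k' = 0 ∧ D.c k' i' = 0
    · exact (allzero_pair_excludes_third D ha₁ hc₁ hσ'.1 hσ'.2.2 ht' hs'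
        (a_ne_or_c_ne_of_not_allzero D hσ) hs ht hss' hs's).elim
    · -- both σ, σ' outside 𝒪: the three types
      exfalso
      rcases a_ne_or_c_ne_of_not_allzero D hσ with ha | hc
      · rcases a_ne_or_c_ne_of_not_allzero D hσ' with ha' | hc'
        · -- both have a ≠ 0: then both have c = 0 (else cross-type), i.e. type 𝒵_c: no_three_separated
          have hc0 : D.c k i = 0 := by
            by_contra hcne; exact not_sep_of_a_ne_c_ne D ha' hcne hs's
          exact no_three_separated D ha hc0 ha' hs hs' hs's
        · exact not_sep_of_a_ne_c_ne D ha hc' hss'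
      · rcases a_ne_or_c_ne_of_not_allzero D hσ' with ha' | hc'
        · exact not_sep_of_a_ne_c_ne D ha' hc hs's
        · -- both have c ≠ 0: then both have a = 0, type 𝒵_a
          have ha0 : D.a i j = 0 := by
            by_contra hane; exact not_sep_of_a_ne_c_ne D hane hc' hss'
          exact azero_no_three_separated D ha₁ ha0 hc hc' ht ht' hss'

end TinyHost

end Summit.MatrixMultiplication.MatrixMultiplication.Theorems.TwistedTPP
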